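import Summits.PneNP.PneNP.Theses.PermanentDescent
import Summits.PneNP.PneNP.Theorems.PermanentDescentPermanentNotInPStubPreimageFST
import Summits.PneNP.PneNP.Theorems.PermanentDescentPermanentNotInPStubGuardFST
import Summits.PneNP.PneNP.Theorems.PermanentDescentPermanentNotInPLadderBase
import Summits.PneNP.PneNP.Theorems.PermanentDescentPermanentNotInPRungMonotone
import Summits.PneNP.PneNP.Theorems.PermanentDescentPermanentNotInPStubPermSharpP
import Summits.PneNP.PneNP.Theorems.PermanentDescentPermanentNotInPStubPermBitsPPP
import Summits.PneNP.PneNP.Theorems.PermanentDescentPermanentNotInPStubTwoEqualRows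
import Summits.PneNP.PneNP.Theorems.PermanentNotInP.Negative.CounterModelCollapse
import Summits.PneNP.PneNP.Theorems.PermanentDescentPermanentNotInPCalibration
import Summits.PneNP.PneNP.Theorems.PermanentDescentPermanentNotInPValiantRungs
import Literature.Computability.Complexity.Transducers
import Literature.Computability.Complexity.BinarySearchPP
import Literature.Computability.Complexity.PRelSigmaPi
import Mathlib.LinearAlgebra.Matrix.Permanent
import HarnessLib.Audit

/-!
# Line `Sketch` (xp-ladder-middle-bits) — skeleton for the crux `PermanentNotInP` (stmt-PneNP-16143)

Route `PermanentDescent`, crux `Summit.PneNP.PneNP.Theses.PermanentDescent.PermanentNotInP`: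
`PermBits ∉ P`, `PermBits = {⟨s, bin i⟩ : s ∈ {0,1}^{n·n}, bit i of perm_ℕ(M_s) = 1}`.

THE LINE (card `Cruxes/PermanentNotInP/Ideas/xp-ladder-middle-bits.md`): the 2-adic precision ladder
`PermLowBits k ⊆ PermBits` (the crux's set-builder plus the guard `i < k`). The crux is the limit rung; it
already follows from the UNBOUNDEDNESS of the fixed-precision exponents,
`UnboundedPrecisionExponent := ∀ c, ∃ k, PermLowBits k ∉ DTIME(n^c)` (stub C, the open core, ≥ crux),
by a uniform-exponent argument: one polynomial-time decider for `PermBits` decides every rung after a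
finite-state guard, with an exponent independent of `k` (stubs A + B, provable now).

* `stub_preimageFST` (A, generic TM2 plumbing, M): `DTIME(n^c)` pulled back along a length-non-increasing
  finite-state transduction lands in `DTIME(n^(c+1))` (`FST.timeComputable_eval` + `comp_outputsWithin`,
  the pattern of `preimage_mem_DTIME_id`).
* `stub_guardFST` (B, M): for every `k` a finite-state transducer `T_k` (copy the input; keep it iff it parses
  as `boolPair s (encodeNat i)` with `i < k`, else output `ε ∉ PermBits`) with
  `T_k.eval w ∈ PermBits ↔ w ∈ PermLowBits k`.
* `stub_unboundedPrecisionExponent` (C, OPEN — implies the crux, hence `P ≠ PP`): `∀ c, ∃ k,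
  PermLowBits k ∉ DTIME(n^c)`.
* SIDE STUBS (registered, landed; structure of the ladder, not links of the composition):
  `stub_ladderBase` — every rung `k ≤ 1` is in `P` (rung 0 = ∅; rung 1 = parity of perm = det mod 2,
  decided through the tree's `IntDetFP.detZ_codeFP`): the crux is FALSE at precision ≤ 1 and C's
  witness is eventually `≥ 2` (`Theorems/PermanentDescentPermanentNotInPLadderBase.lean`, c1 lead);
  `stub_rungMonotone` — `k ≤ k' → PermLowBits k' ∈ DTIME(n^c) → PermLowBits k ∈ DTIME(n^(c+1))`, so C is
  equivalent to its eventual form `∀ c, ∃ k₀, ∀ k ≥ k₀, PermLowBits k ∉ DTIME(n^c)`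
  (`Theorems/PermanentDescentPermanentNotInPRungMonotone.lean`, c1 lead).
* SIDE STUBS OF THE CONTINUATION c2 (registered 2026-08-17, cycle 3; CALIBRATIONS of the line, not links of
  the composition):
  `stub_permSharpP` — the 0/1 permanent of the crux matrix is a `#P`-style witness count of a
  polynomial-time relation (one-hot permutation witnesses), in the exact shape consumed by the tree's
  binary search `BinSearchPP.countsLang_mem_PRelClass_PP`;
  `stub_permBits_mem_PRelClass_PP_of_sharpP` — hence `PermBits ∈ P^{PP}` (the UPPER bound on the crux
  language); with the Disproof's `PP_subset_P_of_mem_P` (Valiant, discharged in the tree) the skeleton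
  proves `crux_iff_not_PP_subset_P : PermanentNotInP ↔ ¬ PP ⊆ P` — the crux is EXACTLY `P ≠ PP`;
  `stub_permanent_two_equal_rows` — a matrix with two equal rows has permanent `2·Σ_{b<b'} v_b v_b' perm(minor)`
  (double Laplace; the engine of Valiant 1979 Thm 3), the algebraic input of
  `stub_valiantRungs` — EVERY rung `PermLowBits k` is in `P` (perm mod `2^k` by elimination with
  correction terms from `(n-2)`-minors mod `2^(k-1)`; Valiant 1979 Thm 3; LANDED p168823 over five Literature
  files): the card's necessary-use constraint `ValiantLowBitsInP` in full — the crux is false at every finite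
  precision, so stub C's witnesses `k(c)` are genuinely unbounded and any proof of the crux must leave every rung;
  `stub_crux_iff_not_PP_subset_P` (LANDED p166020) — the crux is EXACTLY `¬ PP ⊆ P`.
  ALL SIDE STUBS ARE LANDED (2026-08-17, cycle 3); the only sorry left is stub C.
* `permanentNotInP_of_sigs` (sorry-free composition, hypotheses = the stub signatures verbatim, conclusion =
  the crux body verbatim) and `PermanentNotInP_of : PermanentNotInP` (the crux BY NAME).

Disproof used (`Cruxes/PermanentNotInP/Disproof.lean`, cdisprove cycle 1, read 2026-08-17T13:30Z; its Theorems copy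
`Negative/CounterModelCollapse.lean` p161539 imported): §6 `PP_subset_P_of_not_permanentNotInP` (¬crux → PP ⊆ P)
gives the downward half of `crux_iff_not_PP_subset_P`; §7: no
stub of this line is attackable except C (open, ≥ crux, ⇐ non-uniform ⊕ETH); degenerate rungs `c = 0`, `k = 0`
checked there. Lead prover-line-stmt-PneNP-16143-0 (cycle 1), prover-line-stmt-PneNP-16143-c1-0 (cycle 2: side
stubs `stub_ladderBase` p160848, `stub_rungMonotone` p161664), prover-line-stmt-PneNP-16143-c2-0 (cycle 3: this reshape).
-/

set_option linter.dupNamespace false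
set_option linter.unusedVariables false

noncomputable section

namespace Summit.PneNP.PneNP.Cruxes.PermanentNotInP.XpLadder

open Literature.Computability.Complexity
open Summit.PneNP.PneNP.Theses.PermanentDescent

/-! ## The registered stubs -/

/-- **Stub A — LANDED** (`Theorems/PermanentDescentPermanentNotInPStubPreimageFST.lean`, worker of this
lead): `DTIME(n^c)` pulled back along a length-non-increasing finite-state transduction lands in
`DTIME(n^(c+1))`. [cite: AroraBarak2009, §1.3 (composition of machines)] -/
theorem stub_preimageFST :
    ∀ {σ : Type} [Fintype σ] (T : Literature.Computability.Complexity.FST σ Bool Bool)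
      {V : Language Bool} {c : ℕ},
      (∀ w : List Bool, (T.eval w).length ≤ w.length) →
      V ∈ Literature.Computability.Complexity.DTIME (fun n => n ^ c) →
      ({w | T.eval w ∈ V} : Language Bool) ∈
        Literature.Computability.Complexity.DTIME (fun n => n ^ (c + 1)) :=
  fun T _ _ hlen hV => Summit.PneNP.PneNP.Theorems.XpLadder.stub_preimageFST T hlen hV

/-- **Stub B — LANDED** (`Theorems/PermanentDescentPermanentNotInPStubGuardFST.lean`, this lead): the
precision guard as a transducer `guardT k` with `(guardT k).eval ⁻¹' PermBits = PermLowBits k`. [folklore] -/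
theorem stub_guardFST :
    ∀ k : ℕ, ∃ (σ : Type) (_ : Fintype σ) (T : Literature.Computability.Complexity.FST σ Bool Bool),
      (∀ w : List Bool, (T.eval w).length ≤ w.length) ∧
      ∀ w : List Bool,
        (T.eval w ∈ ({w | ∃ (n : ℕ) (s : List Bool) (i : ℕ), s.length = n * n ∧ w = Literature.Computability.Complexity.boolPair s (Computability.encodeNat i) ∧ Nat.testBit (Matrix.permanent (Matrix.of fun a b : Fin n => if s.getD ((b : ℕ) + n * (a : ℕ)) false then (1 : ℕ) else 0)) i = true} : Language Bool)
          ↔ w ∈ ({w | ∃ (n : ℕ) (s : List Bool) (i : ℕ), i < k ∧ s.length = n * n ∧ w = Literature.Computability.Complexity.boolPair s (Computability.encodeNat i) ∧ Nat.testBit (Matrix.permanent (Matrix.of fun a b : Fin n => if s.getD ((b : ℕ) + n * (a : ℕ)) false then (1 : ℕ) else 0)) i = true} : Language Bool)) :=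
  Summit.PneNP.PneNP.Theorems.XpLadder.stub_guardFST

/-- **Side stub `stub_ladderBase` — LANDED** (`Theorems/PermanentDescentPermanentNotInPLadderBase.lean`,
c1 lead): every rung `k ≤ 1` of the ladder is in `P` (perm ≡ det mod 2 + the tree's polynomial-time
integer determinant). The crux is false at precision `≤ 1`. [cite: Valiant1979, Thm. 4 (case k ≤ 1)] -/
theorem stub_ladderBase : ∀ k : ℕ, k ≤ 1 → ({w | ∃ (n : ℕ) (s : List Bool) (i : ℕ), i < k ∧ s.length = n * n ∧ w = Literature.Computability.Complexity.boolPair s (Computability.encodeNat i) ∧ Nat.testBit (Matrix.permanent (Matrix.of fun a b : Fin n => if s.getD ((b : ℕ) + n * (a : ℕ)) false then (1 : ℕ) else 0)) i = true} : Language Bool) ∈ Literature.Computability.Complexity.Classes.P :=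
  Summit.PneNP.PneNP.Theorems.XpLadder.stub_ladderBase

/-- **Side stub `stub_rungMonotone` — LANDED** (`Theorems/PermanentDescentPermanentNotInPRungMonotone.lean`,
c1 lead): the rungs are monotone in difficulty up to one exponent — for `k ≤ k'`, a `DTIME(n^c)` decider
of rung `k'` behind the guard transducer `guardT k` decides rung `k` in `DTIME(n^(c+1))`. Consequently stub C
is equivalent to its eventual form `∀ c, ∃ k₀, ∀ k ≥ k₀, PermLowBits k ∉ DTIME(n^c)`
(`Summit.PneNP.PneNP.Theorems.XpLadder.unboundedPrecisionExponent_iff_eventually`). [folklore] -/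
theorem stub_rungMonotone : ∀ (k k' c : ℕ), k ≤ k' → ({w | ∃ (n : ℕ) (s : List Bool) (i : ℕ), i < k' ∧ s.length = n * n ∧ w = Literature.Computability.Complexity.boolPair s (Computability.encodeNat i) ∧ Nat.testBit (Matrix.permanent (Matrix.of fun a b : Fin n => if s.getD ((b : ℕ) + n * (a : ℕ)) false then (1 : ℕ) else 0)) i = true} : Language Bool) ∈ Literature.Computability.Complexity.DTIME (fun n => n ^ c) → ({w | ∃ (n : ℕ) (s : List Bool) (i : ℕ), i < k ∧ s.length = n * n ∧ w = Literature.Computability.Complexity.boolPair s (Computability.encodeNat i) ∧ Nat.testBit (Matrix.permanent (Matrix.of fun a b : Fin n => if s.getD ((b : ℕ) + n * (a : ℕ)) false then (1 : ℕ) else 0)) i = true} : Language Bool) ∈ Literature.Computability.Complexity.DTIME (fun n => n ^ (c + 1)) :=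
  Summit.PneNP.PneNP.Theorems.XpLadder.stub_rungMonotone

/-- **Stub C in its eventual form** (equivalent to `stub_unboundedPrecisionExponent` by
`stub_rungMonotone`; recorded here so that the planner can carry the open core in either shape):
`∀ c, ∃ k₀, ∀ k ≥ k₀, PermLowBits k ∉ DTIME(n^c)`. [folklore] -/
theorem unboundedPrecisionExponent_iff_eventually :
    (∀ c : ℕ, ∃ k : ℕ,
      ({w | ∃ (n : ℕ) (s : List Bool) (i : ℕ), i < k ∧ s.length = n * n ∧ w = Literature.Computability.Complexity.boolPair s (Computability.encodeNat i) ∧ Nat.testBit (Matrix.permanent (Matrix.of fun a b : Fin n => if s.getD ((b : ℕ) + n * (a : ℕ)) false then (1 : ℕ) else 0)) i = true} : Language Bool)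
        ∉ Literature.Computability.Complexity.DTIME (fun n => n ^ c)) ↔
    (∀ c : ℕ, ∃ k₀ : ℕ, ∀ k : ℕ, k₀ ≤ k →
      ({w | ∃ (n : ℕ) (s : List Bool) (i : ℕ), i < k ∧ s.length = n * n ∧ w = Literature.Computability.Complexity.boolPair s (Computability.encodeNat i) ∧ Nat.testBit (Matrix.permanent (Matrix.of fun a b : Fin n => if s.getD ((b : ℕ) + n * (a : ℕ)) false then (1 : ℕ) else 0)) i = true} : Language Bool)
        ∉ Literature.Computability.Complexity.DTIME (fun n => n ^ c)) :=
  Summit.PneNP.PneNP.Theorems.XpLadder.unboundedPrecisionExponent_iff_eventually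

/-! ## Side stubs of the continuation c2: calibrations of the line -/

/-- **Side stub `stub_permSharpP` (c2) — LANDED p165424** (`Theorems/PermanentDescentPermanentNotInPStubPermSharpP.lean`,
worker W1): **the 0/1 permanent is a witness count of a polynomial-time relation** — there is `V ∈ P` such that for every square word `s` (`|s| = n²`), every bit index `i` and
every tag `t`, the number of `y ∈ {0,1}^{|⟨s, bin i⟩|}` with `⟨⟨⟨s, bin i⟩, t⟩, y⟩ ∈ V` is
`perm_ℕ(M_s)` (one-hot codes of the permutations supported by `M_s`, padded with zeros). This is
`perm ∈ #P` in the exact shape of `ThresholdPP.cntV V X`. [cite: Valiant1979, §2] [cite: AroraBarak2009, Def. 17.2] -/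
theorem stub_permSharpP :
    ∃ V : Language Bool, V ∈ Literature.Computability.Complexity.Classes.P ∧
      ∀ (n : ℕ) (s : List Bool) (i : ℕ) (t : List Bool), s.length = n * n →
        Literature.Computability.Complexity.countWitnesses V
            (Literature.Computability.Complexity.boolPair s (Computability.encodeNat i)).length
            (Literature.Computability.Complexity.boolPair
              (Literature.Computability.Complexity.boolPair s (Computability.encodeNat i)) t) =
          Matrix.permanent (Matrix.of fun a b : Fin n =>
            if s.getD ((b : ℕ) + n * (a : ℕ)) false then (1 : ℕ) else 0) :=
  Summit.PneNP.PneNP.Theorems.XpLadder.stub_permSharpP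

/-- **Side stub `stub_permBits_mem_PRelClass_PP_of_sharpP` (c2) — LANDED p164657**
(`Theorems/PermanentDescentPermanentNotInPStubPermBitsPPP.lean`, worker W2): **`PermBits ∈ P^{PP}` from the
witness count** — binary search with the `PP` threshold oracle recovers all digits of the count
(`BinSearchPP.countsLang_mem_PRelClass_PP`), and a polynomial-time post-processing reads bit `i`.
[cite: AroraBarak2009, Lemma 17.7 (proof)] -/
theorem stub_permBits_mem_PRelClass_PP_of_sharpP :
    (∃ V : Language Bool, V ∈ Literature.Computability.Complexity.Classes.P ∧
      ∀ (n : ℕ) (s : List Bool) (i : ℕ) (t : List Bool), s.length = n * n →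
        Literature.Computability.Complexity.countWitnesses V
            (Literature.Computability.Complexity.boolPair s (Computability.encodeNat i)).length
            (Literature.Computability.Complexity.boolPair
              (Literature.Computability.Complexity.boolPair s (Computability.encodeNat i)) t) =
          Matrix.permanent (Matrix.of fun a b : Fin n =>
            if s.getD ((b : ℕ) + n * (a : ℕ)) false then (1 : ℕ) else 0)) →
    ({w | ∃ (n : ℕ) (s : List Bool) (i : ℕ), s.length = n * n ∧ w = Literature.Computability.Complexity.boolPair s (Computability.encodeNat i) ∧ Nat.testBit (Matrix.permanent (Matrix.of fun a b : Fin n => if s.getD ((b : ℕ) + n * (a : ℕ)) false then (1 : ℕ) else 0)) i = true} : Language Bool)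
      ∈ Literature.Computability.Complexity.PRelClass Literature.Computability.Complexity.PP :=
  Summit.PneNP.PneNP.Theorems.XpLadder.stub_permBits_mem_PRelClass_PP_of_sharpP

/-- **Side stub `stub_permanent_two_equal_rows` (c2) — LANDED p165170** (Literature twin
`Literature.LinearAlgebra.Matrix.permanent_eq_two_mul_sum_of_row_eq`, p164624, worker W3): **the engine of
Valiant's `perm mod 2^k` algorithm** — if rows `a` and `a.succAbove p` of a square matrix agree, its permanent is TWICE the sum,
over column pairs `b < b''` (`b'' = b.succAbove b'` with `b ≤ b'`), of `B a b · B a b'' · perm(minor)`, the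
minor deleting the two equal rows and the two columns (double Laplace expansion along the equal rows,
then symmetry of the unordered pair). [cite: Valiant1979, Thm. 3 (proof)] -/
theorem stub_permanent_two_equal_rows :
    ∀ {R : Type} [CommSemiring R] {n : ℕ} (B : Matrix (Fin (n + 2)) (Fin (n + 2)) R)
      (a : Fin (n + 2)) (p : Fin (n + 1)), B a = B (a.succAbove p) →
      B.permanent = 2 * ∑ b : Fin (n + 2), ∑ b' : Fin (n + 1),
        if (b : ℕ) ≤ (b' : ℕ) then
          B a b * B a (b.succAbove b') *
            (B.submatrix (a.succAbove ∘ p.succAbove) (b.succAbove ∘ b'.succAbove)).permanent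
        else 0 :=
  Summit.PneNP.PneNP.Theorems.XpLadder.stub_permanent_two_equal_rows

/-- **Side stub `stub_valiantRungs` (c2, lead) — LANDED p168823** (`Theorems/PermanentDescentPermanentNotInPValiantRungs.lean`,
over the Literature chain `PermanentModTwoPowAlgorithm` p165145 / `…Steps` p165764 / `…Correct` p166615 (`pm_rows`) /
`PermanentModTwoPowFP` p166507 / `…FPStages` p166912 (`pmFP`)): **EVERY rung of the precision ladder is in `P`**
— for each fixed `k`, the words `⟨s, bin i⟩` with `i < k` and bit `i` of `perm_ℕ(M_s)` set form a
polynomial-time language (`perm mod 2^k` in `O(n^{4k-3})` arithmetic operations: eliminate a column with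
an odd pivot, paying for each row operation a correction `2·Σ_{b<b'}(…)·perm(minor) mod 2^k` that needs
`(n-2)`-minors only mod `2^(k-1)`; an all-even column costs one factor `2` directly). The card's
necessary-use constraint `ValiantLowBitsInP`: the crux is false at every finite precision.
[cite: Valiant1979, Thm. 3] -/
theorem stub_valiantRungs :
    ∀ k : ℕ,
      ({w | ∃ (n : ℕ) (s : List Bool) (i : ℕ), i < k ∧ s.length = n * n ∧ w = Literature.Computability.Complexity.boolPair s (Computability.encodeNat i) ∧ Nat.testBit (Matrix.permanent (Matrix.of fun a b : Fin n => if s.getD ((b : ℕ) + n * (a : ℕ)) false then (1 : ℕ) else 0)) i = true} : Language Bool)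
        ∈ Literature.Computability.Complexity.Classes.P :=
  Summit.PneNP.PneNP.Theorems.XpLadder.stub_valiantRungs

/-! ## Stub C -/

/-- **Stub C (`UnboundedPrecisionExponent`, the open core; implies the crux and hence `P ≠ PP`).**
The fixed-precision rungs `PermLowBits k` (each in `P`: `perm mod 2^k ∈ DTIME(n^{4k+O(1)})`, Valiant 1979
Thm 4) have UNBOUNDED deterministic-time exponents: for every `c` some rung is outside `DTIME(n^c)`.
[cite: Valiant1979, Thm. 4] [cite: CurticapeanXia2015, Thm. 1.3] -/
theorem stub_unboundedPrecisionExponent :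
    ∀ c : ℕ, ∃ k : ℕ,
      ({w | ∃ (n : ℕ) (s : List Bool) (i : ℕ), i < k ∧ s.length = n * n ∧ w = Literature.Computability.Complexity.boolPair s (Computability.encodeNat i) ∧ Nat.testBit (Matrix.permanent (Matrix.of fun a b : Fin n => if s.getD ((b : ℕ) + n * (a : ℕ)) false then (1 : ℕ) else 0)) i = true} : Language Bool)
        ∉ Literature.Computability.Complexity.DTIME (fun n => n ^ c) := by
  sorry

/-! ## The composition (sorry-free) and the skeleton theorem -/

/-- **Composition** (`A → B → C → crux body`; hypotheses = the stub signatures verbatim). If `PermBits ∈ P`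
then `PermBits ∈ DTIME(n^c₀)` for some `c₀`; for every `k` the guard transducer of B pulls it back to
`PermLowBits k ∈ DTIME(n^(c₀+1))` by A — contradicting C at `c = c₀ + 1`. [folklore] -/
theorem permanentNotInP_of_sigs
    (hA : ∀ {σ : Type} [Fintype σ] (T : Literature.Computability.Complexity.FST σ Bool Bool)
      {V : Language Bool} {c : ℕ},
      (∀ w : List Bool, (T.eval w).length ≤ w.length) →
      V ∈ Literature.Computability.Complexity.DTIME (fun n => n ^ c) →
      ({w | T.eval w ∈ V} : Language Bool) ∈
        Literature.Computability.Complexity.DTIME (fun n => n ^ (c + 1)))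
    (hB : ∀ k : ℕ, ∃ (σ : Type) (_ : Fintype σ) (T : Literature.Computability.Complexity.FST σ Bool Bool),
      (∀ w : List Bool, (T.eval w).length ≤ w.length) ∧
      ∀ w : List Bool,
        (T.eval w ∈ ({w | ∃ (n : ℕ) (s : List Bool) (i : ℕ), s.length = n * n ∧ w = Literature.Computability.Complexity.boolPair s (Computability.encodeNat i) ∧ Nat.testBit (Matrix.permanent (Matrix.of fun a b : Fin n => if s.getD ((b : ℕ) + n * (a : ℕ)) false then (1 : ℕ) else 0)) i = true} : Language Bool)
          ↔ w ∈ ({w | ∃ (n : ℕ) (s : List Bool) (i : ℕ), i < k ∧ s.length = n * n ∧ w = Literature.Computability.Complexity.boolPair s (Computability.encodeNat i) ∧ Nat.testBit (Matrix.permanent (Matrix.of fun a b : Fin n => if s.getD ((b : ℕ) + n * (a : ℕ)) false then (1 : ℕ) else 0)) i = true} : Language Bool)))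
    (hC : ∀ c : ℕ, ∃ k : ℕ,
      ({w | ∃ (n : ℕ) (s : List Bool) (i : ℕ), i < k ∧ s.length = n * n ∧ w = Literature.Computability.Complexity.boolPair s (Computability.encodeNat i) ∧ Nat.testBit (Matrix.permanent (Matrix.of fun a b : Fin n => if s.getD ((b : ℕ) + n * (a : ℕ)) false then (1 : ℕ) else 0)) i = true} : Language Bool)
        ∉ Literature.Computability.Complexity.DTIME (fun n => n ^ c)) :
    ({w | ∃ (n : ℕ) (s : List Bool) (i : ℕ), s.length = n * n ∧ w = Literature.Computability.Complexity.boolPair s (Computability.encodeNat i) ∧ Nat.testBit (Matrix.permanent (Matrix.of fun a b : Fin n => if s.getD ((b : ℕ) + n * (a : ℕ)) false then (1 : ℕ) else 0)) i = true} : Language Bool) ∉ Literature.Computability.Complexity.Classes.P := by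
  intro hP
  obtain ⟨c₀, hc₀⟩ := Set.mem_iUnion.1 hP
  obtain ⟨k, hk⟩ := hC (c₀ + 1)
  obtain ⟨σ, inst, T, hlen, hiff⟩ := hB k
  haveI : Fintype σ := inst
  have hpre := hA T hlen hc₀
  refine hk ?_
  convert hpre using 1
  exact (Set.ext hiff).symm

/-- **THE SKELETON THEOREM.** The crux `Summit.PneNP.PneNP.Theses.PermanentDescent.PermanentNotInP`, BY NAME,
from the three declared stubs through the sorry-free composition (the crux's `let` unfolds definitionally).
[folklore] -/
theorem PermanentNotInP_of : Summit.PneNP.PneNP.Theses.PermanentDescent.PermanentNotInP :=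
  permanentNotInP_of_sigs stub_preimageFST stub_guardFST stub_unboundedPrecisionExponent


/-! ## Calibration glue (sorry-free given the side stubs) -/

/-- **`PermBits ∈ P^{PP}`** (upper bound on the crux language), from the two c2 side stubs. [cite: AroraBarak2009, Lemma 17.7] -/
theorem permBits_mem_PRelClass_PP :
    ({w | ∃ (n : ℕ) (s : List Bool) (i : ℕ), s.length = n * n ∧ w = Literature.Computability.Complexity.boolPair s (Computability.encodeNat i) ∧ Nat.testBit (Matrix.permanent (Matrix.of fun a b : Fin n => if s.getD ((b : ℕ) + n * (a : ℕ)) false then (1 : ℕ) else 0)) i = true} : Language Bool)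
      ∈ Literature.Computability.Complexity.PRelClass Literature.Computability.Complexity.PP :=
  stub_permBits_mem_PRelClass_PP_of_sharpP stub_permSharpP

/-- **Side stub `stub_crux_iff_not_PP_subset_P` (c2, lead; registered by `stub-add`) — LANDED p166020**
(`Theorems/PermanentDescentPermanentNotInPCalibration.lean`): **the crux is exactly `P ≠ PP`**, `PermanentNotInP ↔ ¬ PP ⊆ P`.
Upward: `PP ⊆ P` gives `P^{PP} ⊆ P^{P} = P ∋ PermBits` (`permBits_mem_PRelClass_PP`, `PRelClass_mono`,
`PRelClass_P_subset_P`); downward: a polynomial-time `PermBits` gives `PP ⊆ P^{#P} ⊆ P^{per} ⊆ P` — the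
disprover's `Negative.PP_subset_P_of_not_permanentNotInP` (p161539; Valiant's theorem discharged in the tree).
[cite: Valiant1979, Thm. 1] [cite: AroraBarak2009, Lemma 17.7] -/
theorem stub_crux_iff_not_PP_subset_P :
    Summit.PneNP.PneNP.Theses.PermanentDescent.PermanentNotInP ↔
      ¬ (Literature.Computability.Complexity.PP ⊆ Literature.Computability.Complexity.Classes.P) :=
  Summit.PneNP.PneNP.Theorems.XpLadder.stub_crux_iff_not_PP_subset_P

/-- **Every rung is in some `DTIME(n^c)`, while (stub C) every `DTIME(n^c)` misses some rung**: the
exponent sequence of the ladder is finite at each rung and unbounded along the ladder — the formal content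
of the card's framing "the crux is the passage to the limit of the 2-adic precision ladder".
[cite: Valiant1979, Thm. 3] -/
theorem rung_exponents_finite_unbounded :
    (∀ k : ℕ, ∃ c : ℕ,
      ({w | ∃ (n : ℕ) (s : List Bool) (i : ℕ), i < k ∧ s.length = n * n ∧ w = Literature.Computability.Complexity.boolPair s (Computability.encodeNat i) ∧ Nat.testBit (Matrix.permanent (Matrix.of fun a b : Fin n => if s.getD ((b : ℕ) + n * (a : ℕ)) false then (1 : ℕ) else 0)) i = true} : Language Bool)
        ∈ Literature.Computability.Complexity.DTIME (fun n => n ^ c)) ∧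
    (∀ c : ℕ, ∃ k : ℕ,
      ({w | ∃ (n : ℕ) (s : List Bool) (i : ℕ), i < k ∧ s.length = n * n ∧ w = Literature.Computability.Complexity.boolPair s (Computability.encodeNat i) ∧ Nat.testBit (Matrix.permanent (Matrix.of fun a b : Fin n => if s.getD ((b : ℕ) + n * (a : ℕ)) false then (1 : ℕ) else 0)) i = true} : Language Bool)
        ∉ Literature.Computability.Complexity.DTIME (fun n => n ^ c)) :=
  ⟨fun k => Set.mem_iUnion.1 (stub_valiantRungs k), stub_unboundedPrecisionExponent⟩

end Summit.PneNP.PneNP.Cruxes.PermanentNotInP.XpLadder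

end
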